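import Literature.Barriers.NavierStokesRegularity.InstantaneousTypeIBlowupProofs
import HarnessLib

/-!
# Cheskidov–Dai–Palasek 2025, Thm. 1.1: proof architecture two levels down —
# the proof of Thm. 1.1 (§6, p. 25) from the decomposition `u = U(· + T_*) + v + w`

Second sibling proof file (all results proved; no definitions, no named facts) of the barrier
entry `Literature/Barriers/NavierStokesRegularity/InstantaneousTypeIBlowup` (D-0021; A. Cheskidov,
M. Dai, S. Palasek, arXiv:2511.09556 (2025), Thm. 1.1), below
`InstantaneousTypeIBlowupProofs`, whose assembly theorem
`InstantaneousTypeIBlowup_of_construction` reduces the barrier fact to ONE explicit hypothesis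
`hH`: the output of §§3–5 (with Prop. 6.2 and Thm. 1.1 (5)) for an arbitrary classical
background. This file discharges the part of `hH` that the paper proves in §6 ("Proof of
Theorem 1.1", p. 25: the two-sided Type-I bounds and the lower bound of `u = U + v + w` from those
of its three summands) together with the passage from the principal part to `u` in the Orlicz
bounds (5) (which print states in Thm. 1.1 and attributes, in Rmk. 1.3, to the lacunary
frequency structure of the principal part, without a displayed proof), leaving as the new
explicit hypothesis `h₂` of `construction_of_decomposition` exactly the printed intermediate
results about the SUMMANDS: Prop. 4.3 (pointwise bounds of the principal part `v`), Prop. 5.3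
(the corrector `w ∈ B_X(0, δ)` and classicality of `u`), Prop. 6.2 (the `L²` classes and the
continuity at the blow-up time), the lower bound `‖v(tₙ)‖_∞ ≳ tₙ^{-1/2}` of the proof of
Thm. 1.1, and (5) for `v`. As in the sibling file the hypothesis is a slice of the proof of
Thm. 1.1, not a distinct published result, hence NOT a named fact (D-0026).

Proved here:

* `monotoneOn_orliczF`, `monotoneOn_orliczH` — the Orlicz weights of Thm. 1.1 (5) with exponent
  `c = 2`, `F(s) = s²/(1 + (log log(e+s))²)` and `H(s) = s/(1 + (log log(e+s))²)`, are increasing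
  on `[0, ∞)` (derivative test: `s · d/ds (log log(e+s))² ≤ 2 (log ℓ)/ℓ ≤ 2/e < 1`,
  `ℓ = log(e+s)`); doubling `F(2s) ≤ 4F(s)`, `H(2s) ≤ 2H(s)`; whence the domination of the
  weight of a sum, `orliczF_le_of_le_add` (`F(u) ≤ 4a² + 4F(b)` for `0 ≤ u ≤ a + b`) and
  `orliczH_le_of_le_add` (`H(u) ≤ 2a + 2H(b)`). (The weights are NOT monotone for large `c`,
  e.g. `c = 100`; Thm. 1.1 (5) asks for SOME `c > 0`, and `c = 2` is what the lacunary count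
  `∑_k (1 + (k log b)²)⁻¹ < ∞` of Rmk. 1.3 gives.)
* sup-norm bookkeeping on the torus: `exists_norm_fderiv_le`, `norm_le_iSup_norm`,
  `norm_fderiv_le_iSup`, `continuousOn_iSup_of_continuousOn'` (general time sets),
  `continuousOn_iSup_norm'`, `continuousOn_iSup_norm_fderiv'`,
  `exists_norm_fderiv_le_of_isSmoothSpaceTimeOn`, `continuousOn_orliczWeight'`,
  `integrableOn_rpow_neg_Ioo`.
* `construction_of_decomposition` — hypothesis `h₂` (see its docstring, clause by clause with
  locators) implies hypothesis `hH` of `InstantaneousTypeIBlowup_of_construction`, with Orlicz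
  exponents `c = 2`; `InstantaneousTypeIBlowup_of_decomposition` — the composition with the
  sibling assembly: `h₂ → InstantaneousTypeIBlowup`.

Remaining obligation (hypothesis `h₂`; SIZE XL): §3 (the principal part), §4 (Props. 4.1–4.3
with App. Lemmas 7.1–7.3), §5 (Lemma 5.1, Props. 5.2–5.3, `N₀ = 1`, `T̄ = T - T_*`), Prop. 6.2,
the lower bound "`v(tₙ) ∼ tₙ^{-1/2} e^{-1}`", and (5) for `v`.

## References

* A. Cheskidov, M. Dai, S. Palasek, arXiv:2511.09556 (2025): Thm. 1.1, Rmk. 1.3, §1.7,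
  Prop. 4.3, §5.1 (spaces `X`, `Y`), Prop. 5.3, Lemma 6.1, Prop. 6.2, proof of Thm. 1.1 (§6,
  p. 25). [`CheskidovDaiPalasek2025`]
-/

noncomputable section

open MeasureTheory Set Filter Topology
open scoped ENNReal InnerProductSpace ContDiff

namespace Literature.Barriers.NavierStokesRegularity

open Literature.Analysis
open Literature.Analysis.FunctionSpaces.Torus (IsSmooth IsDivFree IsContDiff IsSmoothSpaceTimeOn
  HasZeroMean isSmoothSpaceTimeOn_const)

/-! ## The Orlicz weights of Thm. 1.1 (5) with exponent `c = 2`: monotonicity and doubling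

`F(s) = s² / (1 + (log log(e+s))²)` and `H(s) = s / (1 + (log log(e+s))²)` are increasing on
`[0, ∞)`: with `ℓ = log(e+s) ≥ 1`, `L = log ℓ ≥ 0`, one has `s · d/ds (L²) = 2L s/((e+s)ℓ) ≤
2L/ℓ = 2L e^{-L} ≤ 2/e < 1 ≤ 1 + L²`. -/

section Orlicz

/-- `1 ≤ log(e + s)` for `s ≥ 0`. [folklore] -/
theorem one_le_log_exp_one_add {s : ℝ} (hs : 0 ≤ s) : 1 ≤ Real.log (Real.exp 1 + s) := by
  rw [Real.le_log_iff_exp_le (by positivity)]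
  linarith

/-- `0 ≤ log log(e + s)` for `s ≥ 0`. [folklore] -/
theorem loglog_nonneg {s : ℝ} (hs : 0 ≤ s) : 0 ≤ Real.log (Real.log (Real.exp 1 + s)) :=
  Real.log_nonneg (one_le_log_exp_one_add hs)

/-- `s ↦ log log(e + s)` is monotone on `[0, ∞)`. [folklore] -/
theorem loglog_mono {s s' : ℝ} (hs : 0 ≤ s) (hss' : s ≤ s') :
    Real.log (Real.log (Real.exp 1 + s)) ≤ Real.log (Real.log (Real.exp 1 + s')) := by
  have h1 : 1 ≤ Real.log (Real.exp 1 + s) := one_le_log_exp_one_add hs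
  refine Real.log_le_log (by linarith) (Real.log_le_log (by positivity) (by linarith))

/-- The key derivative bound: for `s ≥ 0`, with `ℓ = log(e+s)` and `L = log ℓ`,
`s · (2 L · (1/(e+s))/ℓ) ≤ 2 e^{-1}`. [folklore] -/
theorem orlicz_key_bound {s : ℝ} (hs : 0 ≤ s) :
    s * (2 * Real.log (Real.log (Real.exp 1 + s)) *
      ((1 / (Real.exp 1 + s)) / Real.log (Real.exp 1 + s))) ≤ 2 * Real.exp (-1) := by
  set ℓ := Real.log (Real.exp 1 + s) with hℓ
  set L := Real.log ℓ with hL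
  have hℓ1 : 1 ≤ ℓ := one_le_log_exp_one_add hs
  have hℓpos : 0 < ℓ := by linarith
  have hL0 : 0 ≤ L := Real.log_nonneg hℓ1
  have hes : 0 < Real.exp 1 + s := by positivity
  -- `ℓ = e^L`
  have hℓL : ℓ = Real.exp L := by rw [hL, Real.exp_log hℓpos]
  have h1 : s / (Real.exp 1 + s) ≤ 1 := by
    rw [div_le_one hes]; linarith [Real.exp_pos 1]
  have h1' : 0 ≤ s / (Real.exp 1 + s) := by positivity
  have h2 : L / ℓ ≤ Real.exp (-1) := by
    rw [hℓL, div_eq_mul_inv, ← Real.exp_neg]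
    -- `L e^{-L} ≤ e^{-1}` from `L ≤ e^{L-1}` (the tree's `MertensContour.mul_exp_neg_le`, inlined)
    have h := Real.add_one_le_exp (L - 1)
    have hx : L ≤ Real.exp (L - 1) := by linarith
    calc L * Real.exp (-L) ≤ Real.exp (L - 1) * Real.exp (-L) :=
          mul_le_mul_of_nonneg_right hx (Real.exp_pos _).le
      _ = Real.exp (-1) := by rw [← Real.exp_add]; ring_nf
  calc s * (2 * L * ((1 / (Real.exp 1 + s)) / ℓ))
      = 2 * (s / (Real.exp 1 + s)) * (L / ℓ) := by
        field_simp
    _ ≤ 2 * 1 * Real.exp (-1) := by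
        refine mul_le_mul (mul_le_mul_of_nonneg_left h1 (by norm_num)) h2
          (div_nonneg hL0 hℓpos.le) (by norm_num)
    _ = 2 * Real.exp (-1) := by ring

/-- Derivative of `P(s) = 1 + (log log(e+s))²` at `s ≥ 0`. [folklore] -/
theorem hasDerivAt_orliczDen {s : ℝ} (hs : 0 ≤ s) :
    HasDerivAt (fun σ => 1 + Real.log (Real.log (Real.exp 1 + σ)) ^ 2)
      (2 * Real.log (Real.log (Real.exp 1 + s)) *
        ((1 / (Real.exp 1 + s)) / Real.log (Real.exp 1 + s))) s := by
  have hes : Real.exp 1 + s ≠ 0 := by positivity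
  have hℓ : Real.log (Real.exp 1 + s) ≠ 0 := by
    have := one_le_log_exp_one_add hs; linarith
  have h1 : HasDerivAt (fun σ => Real.exp 1 + σ) 1 s := (hasDerivAt_id s).const_add _
  have h2 : HasDerivAt (fun σ => Real.log (Real.exp 1 + σ)) (1 / (Real.exp 1 + s)) s := h1.log hes
  have h3 : HasDerivAt (fun σ => Real.log (Real.log (Real.exp 1 + σ)))
      ((1 / (Real.exp 1 + s)) / Real.log (Real.exp 1 + s)) s := h2.log hℓ
  have h4 : HasDerivAt (fun σ => Real.log (Real.log (Real.exp 1 + σ)) ^ 2)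
      (((2 : ℕ) : ℝ) * Real.log (Real.log (Real.exp 1 + s)) ^ (2 - 1) *
        ((1 / (Real.exp 1 + s)) / Real.log (Real.exp 1 + s))) s := h3.pow 2
  refine (h4.const_add 1).congr_deriv ?_
  norm_num

/-- **`F(s) = s²/(1 + (log log(e+s))²)` is monotone on `[0, ∞)`.** [folklore] -/
theorem monotoneOn_orliczF :
    MonotoneOn (fun s : ℝ => s ^ 2 / (1 + Real.log (Real.log (Real.exp 1 + s)) ^ 2)) (Ici 0) := by
  have hP : ∀ s : ℝ, 0 ≤ s → 1 ≤ 1 + Real.log (Real.log (Real.exp 1 + s)) ^ 2 := fun s _ => by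
    nlinarith [sq_nonneg (Real.log (Real.log (Real.exp 1 + s)))]
  have hderiv : ∀ s : ℝ, 0 < s → HasDerivAt
      (fun σ : ℝ => σ ^ 2 / (1 + Real.log (Real.log (Real.exp 1 + σ)) ^ 2))
      ((2 * s * (1 + Real.log (Real.log (Real.exp 1 + s)) ^ 2) -
        s ^ 2 * (2 * Real.log (Real.log (Real.exp 1 + s)) *
          ((1 / (Real.exp 1 + s)) / Real.log (Real.exp 1 + s)))) /
        (1 + Real.log (Real.log (Real.exp 1 + s)) ^ 2) ^ 2) s := by
    intro s hs
    have hnum : HasDerivAt (fun σ : ℝ => σ ^ 2) (2 * s) s :=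
      (hasDerivAt_pow 2 s).congr_deriv (by norm_num)
    exact hnum.div (hasDerivAt_orliczDen hs.le) (by linarith [hP s hs.le])
  refine monotoneOn_of_deriv_nonneg (convex_Ici 0) ?_ ?_ ?_
  · intro s hs
    have hsD : ∀ σ ∈ Ici (0 : ℝ), (1 + Real.log (Real.log (Real.exp 1 + σ)) ^ 2) ≠ 0 :=
      fun σ hσ => by linarith [hP σ hσ]
    have hc1 : ContinuousOn (fun σ : ℝ => Real.log (Real.exp 1 + σ)) (Ici 0) :=
      (continuousOn_const.add continuousOn_id).log fun σ hσ =>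
        (add_pos_of_pos_of_nonneg (Real.exp_pos 1) (show (0 : ℝ) ≤ σ from hσ)).ne'
    have hc2 : ContinuousOn (fun σ : ℝ => Real.log (Real.log (Real.exp 1 + σ))) (Ici 0) :=
      hc1.log fun σ hσ => by have := one_le_log_exp_one_add (show (0:ℝ) ≤ σ from hσ); linarith
    exact ((continuousOn_id.pow 2).div (continuousOn_const.add (hc2.pow 2)) hsD) s hs
  · rw [interior_Ici]
    exact fun s hs => (hderiv s hs).differentiableAt.differentiableWithinAt
  · rw [interior_Ici]
    intro s hs
    rw [(hderiv s hs).deriv]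
    refine div_nonneg ?_ (sq_nonneg _)
    have hk := orlicz_key_bound hs.le
    have hs0 : 0 ≤ s := hs.le
    have he : Real.exp (-1) ≤ 1 := by
      rw [Real.exp_le_one_iff]; norm_num
    nlinarith [hP s hs.le, hk, he]

/-- **`H(s) = s/(1 + (log log(e+s))²)` is monotone on `[0, ∞)`.** [folklore] -/
theorem monotoneOn_orliczH :
    MonotoneOn (fun s : ℝ => s / (1 + Real.log (Real.log (Real.exp 1 + s)) ^ 2)) (Ici 0) := by
  have hP : ∀ s : ℝ, 0 ≤ s → 1 ≤ 1 + Real.log (Real.log (Real.exp 1 + s)) ^ 2 := fun s _ => by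
    nlinarith [sq_nonneg (Real.log (Real.log (Real.exp 1 + s)))]
  have hderiv : ∀ s : ℝ, 0 < s → HasDerivAt
      (fun σ : ℝ => σ / (1 + Real.log (Real.log (Real.exp 1 + σ)) ^ 2))
      ((1 * (1 + Real.log (Real.log (Real.exp 1 + s)) ^ 2) -
        s * (2 * Real.log (Real.log (Real.exp 1 + s)) *
          ((1 / (Real.exp 1 + s)) / Real.log (Real.exp 1 + s)))) /
        (1 + Real.log (Real.log (Real.exp 1 + s)) ^ 2) ^ 2) s := by
    intro s hs
    exact (hasDerivAt_id s).div (hasDerivAt_orliczDen hs.le) (by linarith [hP s hs.le])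
  refine monotoneOn_of_deriv_nonneg (convex_Ici 0) ?_ ?_ ?_
  · intro s hs
    have hsD : ∀ σ ∈ Ici (0 : ℝ), (1 + Real.log (Real.log (Real.exp 1 + σ)) ^ 2) ≠ 0 :=
      fun σ hσ => by linarith [hP σ hσ]
    have hc1 : ContinuousOn (fun σ : ℝ => Real.log (Real.exp 1 + σ)) (Ici 0) :=
      (continuousOn_const.add continuousOn_id).log fun σ hσ =>
        (add_pos_of_pos_of_nonneg (Real.exp_pos 1) (show (0 : ℝ) ≤ σ from hσ)).ne'
    have hc2 : ContinuousOn (fun σ : ℝ => Real.log (Real.log (Real.exp 1 + σ))) (Ici 0) :=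
      hc1.log fun σ hσ => by have := one_le_log_exp_one_add (show (0:ℝ) ≤ σ from hσ); linarith
    exact (continuousOn_id.div (continuousOn_const.add (hc2.pow 2)) hsD) s hs
  · rw [interior_Ici]
    exact fun s hs => (hderiv s hs).differentiableAt.differentiableWithinAt
  · rw [interior_Ici]
    intro s hs
    rw [(hderiv s hs).deriv]
    refine div_nonneg ?_ (sq_nonneg _)
    have hk := orlicz_key_bound hs.le
    have he : Real.exp (-1) ≤ 1 / 2 := by
      have h := Real.exp_one_gt_d9
      rw [Real.exp_neg]
      rw [inv_le_comm₀ (Real.exp_pos 1) (by norm_num : (0:ℝ) < 1 / 2)]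
      norm_num at h ⊢
      linarith
    nlinarith [hP s hs.le, hk, he]

/-- `F(s) ≤ s²` (`s ≥ 0` not needed). [folklore] -/
theorem orliczF_le_sq (s : ℝ) :
    s ^ 2 / (1 + Real.log (Real.log (Real.exp 1 + s)) ^ 2) ≤ s ^ 2 :=
  div_le_self (sq_nonneg s) (by nlinarith [sq_nonneg (Real.log (Real.log (Real.exp 1 + s)))])

/-- `H(s) ≤ s` for `s ≥ 0`. [folklore] -/
theorem orliczH_le_self {s : ℝ} (hs : 0 ≤ s) :
    s / (1 + Real.log (Real.log (Real.exp 1 + s)) ^ 2) ≤ s :=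
  div_le_self hs (by nlinarith [sq_nonneg (Real.log (Real.log (Real.exp 1 + s)))])

/-- `0 ≤ F(s)`. [folklore] -/
theorem orliczF_nonneg (s : ℝ) : 0 ≤ s ^ 2 / (1 + Real.log (Real.log (Real.exp 1 + s)) ^ 2) :=
  div_nonneg (sq_nonneg s) (by nlinarith [sq_nonneg (Real.log (Real.log (Real.exp 1 + s)))])

/-- `0 ≤ H(s)` for `s ≥ 0`. [folklore] -/
theorem orliczH_nonneg {s : ℝ} (hs : 0 ≤ s) :
    0 ≤ s / (1 + Real.log (Real.log (Real.exp 1 + s)) ^ 2) :=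
  div_nonneg hs (by nlinarith [sq_nonneg (Real.log (Real.log (Real.exp 1 + s)))])

/-- Doubling: `F(2s) ≤ 4 F(s)` for `s ≥ 0`. [folklore] -/
theorem orliczF_two_mul_le {s : ℝ} (hs : 0 ≤ s) :
    (2 * s) ^ 2 / (1 + Real.log (Real.log (Real.exp 1 + 2 * s)) ^ 2) ≤
      4 * (s ^ 2 / (1 + Real.log (Real.log (Real.exp 1 + s)) ^ 2)) := by
  have hL := loglog_mono hs (by linarith : s ≤ 2 * s)
  have hL0 := loglog_nonneg hs
  rw [mul_div_assoc']
  refine div_le_div₀ (by positivity) (by nlinarith) (by nlinarith) ?_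
  nlinarith

/-- Doubling: `H(2s) ≤ 2 H(s)` for `s ≥ 0`. [folklore] -/
theorem orliczH_two_mul_le {s : ℝ} (hs : 0 ≤ s) :
    (2 * s) / (1 + Real.log (Real.log (Real.exp 1 + 2 * s)) ^ 2) ≤
      2 * (s / (1 + Real.log (Real.log (Real.exp 1 + s)) ^ 2)) := by
  have hL := loglog_mono hs (by linarith : s ≤ 2 * s)
  have hL0 := loglog_nonneg hs
  rw [mul_div_assoc']
  refine div_le_div₀ (by positivity) le_rfl (by nlinarith) ?_
  nlinarith

/-- **Domination of the Orlicz weight of a sum**: for `0 ≤ u ≤ a + b` with `a, b ≥ 0`,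
`F(u) ≤ 4a² + 4F(b)` (monotonicity, `u ≤ 2 max(a,b)`, doubling, `F ≤ (·)²`). [folklore] -/
theorem orliczF_le_of_le_add {u a b : ℝ} (hu : 0 ≤ u) (ha : 0 ≤ a) (hb : 0 ≤ b)
    (hle : u ≤ a + b) :
    u ^ 2 / (1 + Real.log (Real.log (Real.exp 1 + u)) ^ 2) ≤
      4 * a ^ 2 + 4 * (b ^ 2 / (1 + Real.log (Real.log (Real.exp 1 + b)) ^ 2)) := by
  rcases le_total a b with hab | hab
  · -- `u ≤ 2b`
    have h1 := monotoneOn_orliczF hu (show (0:ℝ) ≤ 2 * b by positivity) (by linarith)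
    simp only at h1
    have h2 := orliczF_two_mul_le hb
    nlinarith [sq_nonneg a]
  · -- `u ≤ 2a`
    have h1 := monotoneOn_orliczF hu (show (0:ℝ) ≤ 2 * a by positivity) (by linarith)
    simp only at h1
    have h2 := orliczF_le_sq (2 * a)
    have h3 := orliczF_nonneg b
    nlinarith

/-- **Domination of the Orlicz weight of a sum**: for `0 ≤ u ≤ a + b` with `a, b ≥ 0`,
`H(u) ≤ 2a + 2H(b)`. [folklore] -/
theorem orliczH_le_of_le_add {u a b : ℝ} (hu : 0 ≤ u) (ha : 0 ≤ a) (hb : 0 ≤ b)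
    (hle : u ≤ a + b) :
    u / (1 + Real.log (Real.log (Real.exp 1 + u)) ^ 2) ≤
      2 * a + 2 * (b / (1 + Real.log (Real.log (Real.exp 1 + b)) ^ 2)) := by
  rcases le_total a b with hab | hab
  · have h1 := monotoneOn_orliczH hu (show (0:ℝ) ≤ 2 * b by positivity) (by linarith)
    simp only at h1
    have h2 := orliczH_two_mul_le hb
    nlinarith
  · have h1 := monotoneOn_orliczH hu (show (0:ℝ) ≤ 2 * a by positivity) (by linarith)
    simp only at h1
    have h2 := orliczH_le_self (show (0:ℝ) ≤ 2 * a by positivity)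
    have h3 := orliczH_nonneg hb
    nlinarith

end Orlicz

/-! ## Bookkeeping: sup norms on the torus, bounds of classical backgrounds, power weights -/

section SupNorms

variable {d : Type*} [Fintype d]

/-- The spatial derivative of a smooth field on the torus is bounded (continuity of
`D(lift f)` on the compact unit cube, `Torus.fderiv_lift`). [folklore] -/
theorem exists_norm_fderiv_le {F : Type*} [NormedAddCommGroup F] [NormedSpace ℝ F]
    {f : UnitAddTorus d → F} (hf : IsSmooth f) :
    ∃ C : ℝ, ∀ x, ‖FunctionSpaces.Torus.fderiv f x‖ ≤ C := by
  have hc : Continuous (_root_.fderiv ℝ (FunctionSpaces.Torus.lift f)) :=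
    (hf : ContDiff ℝ _ _).continuous_fderiv (by simp)
  obtain ⟨C, hC⟩ := FunctionSpaces.Torus.isCompact_toLp_image_pi_Icc.exists_bound_of_continuousOn
    (f := _root_.fderiv ℝ (FunctionSpaces.Torus.lift f)) hc.continuousOn
  refine ⟨C, fun x => ?_⟩
  have h := hC (FunctionSpaces.Torus.repr x) (FunctionSpaces.Torus.repr_mem_toLp_image_pi_Icc x)
  rwa [FunctionSpaces.Torus.fderiv_lift, FunctionSpaces.Torus.proj_repr] at h

omit [Fintype d] in
/-- `‖f(x)‖ ≤ sup_y ‖f(y)‖` for continuous `f` on the compact torus. [folklore] -/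
theorem norm_le_iSup_norm {F : Type*} [NormedAddCommGroup F] {f : UnitAddTorus d → F}
    (hf : Continuous f) (x : UnitAddTorus d) : ‖f x‖ ≤ ⨆ y, ‖f y‖ :=
  le_ciSup (f := fun y => ‖f y‖) (isCompact_range hf.norm).bddAbove x

/-- `‖Df(x)‖ ≤ sup_y ‖Df(y)‖` for smooth `f` on the torus. [folklore] -/
theorem norm_fderiv_le_iSup {F : Type*} [NormedAddCommGroup F] [NormedSpace ℝ F]
    {f : UnitAddTorus d → F} (hf : IsSmooth f) (x : UnitAddTorus d) :
    ‖FunctionSpaces.Torus.fderiv f x‖ ≤ ⨆ y, ‖FunctionSpaces.Torus.fderiv f y‖ := by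
  obtain ⟨C, hC⟩ := exists_norm_fderiv_le hf
  exact le_ciSup (f := fun y => ‖FunctionSpaces.Torus.fderiv f y‖)
    ⟨C, by rintro _ ⟨y, rfl⟩; exact hC y⟩ x

omit [Fintype d] in
/-- **Sup norms of slices depend continuously on time** (general time set): if
`(t, y) ↦ h t (proj y)` is continuous on `S × ℝ^d`, then `t ↦ sup_x h t x` is continuous on `S`
(twin of `continuousOn_iSup_of_continuousOn`, which is the case `S = [a, b]`). [folklore] -/
theorem continuousOn_iSup_of_continuousOn' {S : Set ℝ} {h : ℝ → UnitAddTorus d → ℝ}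
    (hc : ContinuousOn (FunctionSpaces.Torus.stLift h) (S ×ˢ univ)) :
    ContinuousOn (fun t => ⨆ x, h t x) S := by
  set K : Set (EuclideanSpace ℝ d) :=
    ((WithLp.toLp 2) '' (Set.pi univ fun _ : d => Icc (0 : ℝ) 1)) with hK
  have hKc : IsCompact K := FunctionSpaces.Torus.isCompact_toLp_image_pi_Icc
  have h1 : Continuous fun p : S × EuclideanSpace ℝ d =>
      FunctionSpaces.Torus.stLift h ((p.1 : ℝ), p.2) :=
    hc.comp_continuous ((continuous_subtype_val.comp continuous_fst).prodMk continuous_snd)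
      fun p => ⟨p.1.2, mem_univ _⟩
  have h2 : Continuous fun s : S =>
      sSup ((fun y => FunctionSpaces.Torus.stLift h ((s : ℝ), y)) '' K) :=
    hKc.continuous_sSup (f := fun (s : S) (y : EuclideanSpace ℝ d) =>
      FunctionSpaces.Torus.stLift h ((s : ℝ), y)) h1
  have hEq : ∀ t : ℝ, sSup ((fun y => FunctionSpaces.Torus.stLift h (t, y)) '' K) = ⨆ x, h t x := by
    intro t
    have hset : (fun y => FunctionSpaces.Torus.stLift h (t, y)) '' K = range fun x => h t x := by
      ext r
      constructor
      · rintro ⟨y, -, rfl⟩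
        exact ⟨FunctionSpaces.Torus.proj y, rfl⟩
      · rintro ⟨x, rfl⟩
        exact ⟨FunctionSpaces.Torus.repr x, FunctionSpaces.Torus.repr_mem_toLp_image_pi_Icc x,
          by simp [FunctionSpaces.Torus.proj_repr]⟩
    rw [hset]
    rfl
  rw [continuousOn_iff_continuous_restrict]
  refine h2.congr fun s => ?_
  exact hEq s

/-- The sup norm `t ↦ sup_x ‖u(t, x)‖` of a jointly smooth field is continuous in time
(general time set). [folklore] -/
theorem continuousOn_iSup_norm' {S : Set ℝ} {u : ℝ → UnitAddTorus d → EuclideanSpace ℝ d}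
    (hu : IsSmoothSpaceTimeOn S u) : ContinuousOn (fun t => ⨆ x, ‖u t x‖) S :=
  continuousOn_iSup_of_continuousOn' (h := fun t x => ‖u t x‖) hu.continuousOn_stLift.norm

/-- The sup norm `t ↦ sup_x ‖∇u(t, x)‖` of a jointly smooth field is continuous in time
(general time set of unique differentiability). [folklore] -/
theorem continuousOn_iSup_norm_fderiv' {S : Set ℝ} (hS : UniqueDiffOn ℝ S)
    {u : ℝ → UnitAddTorus d → EuclideanSpace ℝ d} (hu : IsSmoothSpaceTimeOn S u) :
    ContinuousOn (fun t => ⨆ x, ‖FunctionSpaces.Torus.fderiv (u t) x‖) S := by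
  have hU : UniqueDiffOn ℝ (S ×ˢ (univ : Set (EuclideanSpace ℝ d))) := hS.prod uniqueDiffOn_univ
  set G : ℝ × EuclideanSpace ℝ d → EuclideanSpace ℝ d →L[ℝ] EuclideanSpace ℝ d := fun p =>
    (fderivWithin ℝ (FunctionSpaces.Torus.stLift u) (S ×ˢ univ) p).comp
      (ContinuousLinearMap.inr ℝ ℝ (EuclideanSpace ℝ d)) with hG
  have hD : ContDiffOn ℝ (⊤ : ℕ∞)
      (fun p => fderivWithin ℝ (FunctionSpaces.Torus.stLift u) (S ×ˢ univ) p) (S ×ˢ univ) :=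
    hu.fderivWithin hU le_rfl
  have hGc : ContinuousOn G (S ×ˢ univ) :=
    ((ContinuousLinearMap.compL ℝ (EuclideanSpace ℝ d) (ℝ × EuclideanSpace ℝ d)
      (EuclideanSpace ℝ d)).flip (ContinuousLinearMap.inr ℝ ℝ (EuclideanSpace ℝ d))).continuous
      |>.comp_continuousOn hD.continuousOn
  have hEq : ∀ p ∈ S ×ˢ (univ : Set (EuclideanSpace ℝ d)),
      FunctionSpaces.Torus.stLift (fun t x => ‖FunctionSpaces.Torus.fderiv (u t) x‖) p = ‖G p‖ := by
    rintro ⟨t, y⟩ hp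
    rw [FunctionSpaces.Torus.stLift_apply]
    congr 1
    ext w
    · rw [hu.fderiv_slice_apply (mem_prod.1 hp).1]
      rfl
  refine continuousOn_iSup_of_continuousOn' (h := fun t x => ‖FunctionSpaces.Torus.fderiv (u t) x‖) ?_
  exact (hGc.norm).congr hEq

/-- A uniform bound of the spatial derivative of a jointly smooth field on a compact time
interval. [folklore] -/
theorem exists_norm_fderiv_le_of_isSmoothSpaceTimeOn {a b : ℝ} (hab : a < b)
    {u : ℝ → UnitAddTorus d → EuclideanSpace ℝ d} (hu : IsSmoothSpaceTimeOn (Icc a b) u) :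
    ∃ M : ℝ, ∀ t ∈ Icc a b, ∀ x, ‖FunctionSpaces.Torus.fderiv (u t) x‖ ≤ M := by
  obtain ⟨M, hM⟩ := isCompact_Icc.exists_bound_of_continuousOn
    (continuousOn_iSup_norm_fderiv hab hu)
  refine ⟨M, fun t ht x => ?_⟩
  exact (norm_fderiv_le_iSup (hu.isSmooth_slice ht) x).trans ((le_abs_self _).trans (hM t ht))

/-- The Orlicz weights are continuous along a continuous nonnegative function (general set).
[folklore] -/
theorem continuousOn_orliczWeight' {S : Set ℝ} {c : ℝ} (hc : 0 < c) (m : ℕ) {g : ℝ → ℝ}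
    (hg : ContinuousOn g S) (hg0 : ∀ t, 0 ≤ g t) :
    ContinuousOn (fun t => g t ^ m /
      (1 + Real.log (Real.log (Real.exp 1 + g t)) ^ c)) S := by
  have he : ∀ t, 0 < Real.exp 1 + g t := fun t => add_pos_of_pos_of_nonneg (Real.exp_pos 1) (hg0 t)
  have hlog1 : ∀ t, 1 ≤ Real.log (Real.exp 1 + g t) := fun t => by
    rw [Real.le_log_iff_exp_le (he t)]
    linarith [hg0 t]
  have hlog2 : ∀ t, 0 ≤ Real.log (Real.log (Real.exp 1 + g t)) := fun t =>
    Real.log_nonneg (hlog1 t)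
  have h1 : ContinuousOn (fun t => Real.log (Real.exp 1 + g t)) S :=
    (continuousOn_const.add hg).log fun t _ => (he t).ne'
  have h2 : ContinuousOn (fun t => Real.log (Real.log (Real.exp 1 + g t))) S :=
    h1.log fun t _ => by linarith [hlog1 t]
  have h3 : ContinuousOn (fun t => Real.log (Real.log (Real.exp 1 + g t)) ^ c) S :=
    h2.rpow_const fun t _ => Or.inr hc.le
  refine (hg.pow m).div (continuousOn_const.add h3) fun t _ => ?_
  have : 0 ≤ Real.log (Real.log (Real.exp 1 + g t)) ^ c := Real.rpow_nonneg (hlog2 t) c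
  linarith

omit [Fintype d] in
/-- `t ↦ t^{-γ}` is integrable on `(0, τ)` for `γ < 1`. [folklore] -/
theorem integrableOn_rpow_neg_Ioo {γ τ : ℝ} (hγ : γ < 1) (hτ : 0 ≤ τ) :
    IntegrableOn (fun t : ℝ => t ^ (-γ)) (Ioo 0 τ) :=
  (intervalIntegrable_iff_integrableOn_Ioo_of_le hτ).1
    (intervalIntegral.intervalIntegrable_rpow' (by linarith))

end SupNorms

/-! ## The decomposition level: Thm. 1.1 (as hypothesis `hH` of
`InstantaneousTypeIBlowup_of_construction`) from `u = U(· + T_*) + v + w` -/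

section Decomposition

/-- **Cheskidov–Dai–Palasek 2025: the proof of Thm. 1.1 (§6, p. 25) and the bookkeeping of
Prop. 6.2, from the decomposition `u = U(· + T_*) + v + w` — proved.** HYPOTHESIS `h₂` (the
remaining proof obligation one level below `InstantaneousTypeIBlowup_of_construction`; NOT a
named fact, D-0026): for `n ≥ 2` there is `T₁ > 0` such that for every classical background
`(U, P)` on `[0, T] × 𝕋ⁿ`, `0 < T ≤ T₁`, and every `T_* ∈ [0, T)`, writing `τ = T - T_*` and
`Ũ = U(· + T_*)` (§1.7: "we may translate in time"), there are the PRINCIPAL PART `v` (§3), the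
CORRECTOR `w` and a pressure `q` (§5) such that, with `u = Ũ + v + w`:
* `(u, q)` is a classical solution on `(0, τ] × 𝕋ⁿ` [Prop. 5.3 with `N₀ = 1`, `T̄ = τ`:
  "`u^{1/N₀} = U^{1/N₀} + v + w` solving (NSE)", classical by Rmk. 1.9];
* `v(t)` is smooth on `𝕋ⁿ` for `t ∈ (0, τ]` [§3: `v` is an explicit series of smooth blocks,
  converging with all derivatives for `t > 0`; Prop. 4.3: `v` solves (4.5) classically];
* `‖v(t,x)‖ ≤ K/√t`, `‖∇v(t,x)‖ ≤ K/t` [Prop. 4.3, (v-pointwise-bounds) with `n = 0, 1`];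
* `‖w(t,x)‖ ≤ δ t^{-β₀}`, `‖∇w(t,x)‖ ≤ δ t^{-β₁}` with `β₀ < 1/2`, `β₁ < 1` [Prop. 5.3:
  `w ∈ B_X(0, δ)`, `‖V‖_X = sup_t (t^{(1-α)/2}‖V‖_∞ + t^{(2-α)/2}‖∇V‖_{C^κ})` (§5.1), so
  `β₀ = (1-α)/2`; for `∇w`, interpolation of `‖w‖_∞` and `[∇w]_{C^κ}` on `𝕋ⁿ` gives
  `β₁ = (2+κ)/(2(1+κ)) - α/2 < 1`];
* the lower bound `‖v(s_k, x_k)‖ ≥ c₀/√s_k` along `s_k → 0⁺` [proof of Thm. 1.1: "there exists a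
  time sequence `tₙ → 0+` such that the principal velocity field `v` satisfies
  `v(tₙ) ∼ tₙ^{-1/2} e^{-1}`"];
* `v(t) → 0` and `w(t) → 0` in `𝒟'(𝕋ⁿ)` as `t → 0⁺` [Prop. 6.2: `u ∈ X_{[0,τ]}`, weak-*
  continuous into `BMO⁻¹` with `u(0) = U(T_*)`, and `‖w(t)‖_{Ẇ^{-1,∞}} ≲ t^{α-ε} + t → 0`];
* `u ∈ L²((0,τ) × 𝕋ⁿ)` and `u ∈ L²(0, τ; L^p)` for all `p < ∞` [Prop. 6.2 as printed:
  "`u ∈ L^{2,∞}_t L^∞_x ∩ L²_t L^p_x` for all `p < ∞`"];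
* the principal part obeys the Orlicz bounds of Thm. 1.1 (5) with exponent `c = 2`:
  `∫₀^τ ‖v‖²_∞/(1 + (log log(e + ‖v‖_∞))²) < ∞`, `∫₀^τ ‖∇v‖_∞/(1 + (log log(e + ‖∇v‖_∞))²) < ∞`
  [Rmk. 1.3: "the construction involves an increasing sequence of frequency scales `N_k` …
  `f` is allowed to grow roughly as the inverse function of `k ↦ N_k`"; for the
  double-exponential `N_k` each scale contributes `O(1)` to `∫‖v‖²_∞` and `∫‖∇v‖_∞` with weight
  `≲ k^{-2}`; print displays no proof of (5)].
CONCLUSION: the hypothesis `hH` of `InstantaneousTypeIBlowup_of_construction` verbatim, with the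
Orlicz exponents `c = 2`. The Lean content: the `𝒟'`-limit `∫⟪u(t), φ⟫ → ∫⟪U(T_*), φ⟫`
(continuity of `t ↦ ∫⟪U(t), φ⟫` within `[0, T]`, plus the two printed limits); the lower bound
`‖u(s_k, x_k)‖ ≥ c₀/√s_k - M - δ s_k^{-β₀} ≥ (c₀/2)/√s_k` for `k ≥ k₀` (proof of Thm. 1.1:
"`‖u(tₙ)‖_∞ ≥ ‖v(tₙ)‖_∞ - ‖U(tₙ)‖_∞ - ‖w(tₙ)‖_∞ ≳ tₙ^{-1/2}`"); the Type-I bounds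
`‖u‖ ≤ M + K/√t + δt^{-β₀} ≤ C/√t`, `‖∇u‖ ≤ M₁ + K/t + δ t^{-β₁} ≤ C/t` on `(0, τ]` (proof of
Thm. 1.1: "the upper bound `‖U(t)‖ ≲ t^{-1/2}` … the principal part `v` also satisfies this upper
bound … `‖w(t)‖_∞ ≲ t^{-1/2+α/2} ≲ t^{-1/2}`"); and the Orlicz bounds (5) for `u` from those of
`v`: the weights `F(s) = s²/(1+(log log(e+s))²)`, `H(s) = s/(1+(log log(e+s))²)` are increasing
(`monotoneOn_orliczF`, `monotoneOn_orliczH`), so `F(‖u‖_∞) ≤ 4(M + δt^{-β₀})² + 4F(‖v‖_∞)`,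
`H(‖∇u‖_∞) ≤ 2(M₁ + δt^{-β₁}) + 2H(‖∇v‖_∞)` (`orliczF_le_of_le_add`, `orliczH_le_of_le_add`),
integrable since `2β₀ < 1`, `β₁ < 1`.
[cite: CheskidovDaiPalasek2025, §6 (proof of Thm. 1.1), Prop. 4.3, Prop. 5.3, Prop. 6.2, Rmk. 1.3] -/
theorem construction_of_decomposition
    (h₂ : ∀ (n : ℕ), 2 ≤ n → ∃ T₁ : ℝ, 0 < T₁ ∧ ∀ (T : ℝ), 0 < T → T ≤ T₁ →
      ∀ (U : ℝ → UnitAddTorus (Fin n) → EuclideanSpace ℝ (Fin n))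
        (P : ℝ → UnitAddTorus (Fin n) → ℝ),
        FunctionSpaces.Torus.IsClassicalNSSolutionOn (Icc 0 T) 1 0 U P →
        ∀ Ts : ℝ, 0 ≤ Ts → Ts < T →
          ∃ (v w : ℝ → UnitAddTorus (Fin n) → EuclideanSpace ℝ (Fin n))
            (q : ℝ → UnitAddTorus (Fin n) → ℝ),
            FunctionSpaces.Torus.IsClassicalNSSolutionOn (Ioc 0 (T - Ts)) 1 0
              (fun t x => U (t + Ts) x + v t x + w t x) q ∧
            (∀ t ∈ Ioc 0 (T - Ts), IsSmooth (v t)) ∧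
            (∃ K : ℝ, ∀ t ∈ Ioc 0 (T - Ts), ∀ x, ‖v t x‖ ≤ K / Real.sqrt t ∧
              ‖FunctionSpaces.Torus.fderiv (v t) x‖ ≤ K / t) ∧
            (∃ δ β₀ β₁ : ℝ, β₀ < 1 / 2 ∧ β₁ < 1 ∧ ∀ t ∈ Ioc 0 (T - Ts), ∀ x,
              ‖w t x‖ ≤ δ * t ^ (-β₀) ∧ ‖FunctionSpaces.Torus.fderiv (w t) x‖ ≤ δ * t ^ (-β₁)) ∧
            (∃ c₀ : ℝ, 0 < c₀ ∧ ∃ s : ℕ → ℝ, (∀ k, 0 < s k ∧ s k ≤ T - Ts) ∧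
              Tendsto s atTop (𝓝 0) ∧ ∀ k, ∃ x, c₀ / Real.sqrt (s k) ≤ ‖v (s k) x‖) ∧
            (∀ φ : UnitAddTorus (Fin n) → EuclideanSpace ℝ (Fin n), IsSmooth φ →
              Tendsto (fun t => ∫ x, ⟪v t x, φ x⟫_ℝ) (𝓝[>] 0) (𝓝 0)) ∧
            (∀ φ : UnitAddTorus (Fin n) → EuclideanSpace ℝ (Fin n), IsSmooth φ →
              Tendsto (fun t => ∫ x, ⟪w t x, φ x⟫_ℝ) (𝓝[>] 0) (𝓝 0)) ∧
            (∫⁻ t in Ioo 0 (T - Ts), ∫⁻ x, ‖U (t + Ts) x + v t x + w t x‖ₑ ^ 2 < ⊤) ∧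
            (∀ p : ℝ, 1 ≤ p → FluidPDE.Torus.MemLqLp 2 (ENNReal.ofReal p)
              (fun t x => U (t + Ts) x + v t x + w t x) (Ioo 0 (T - Ts))) ∧
            IntegrableOn (fun t : ℝ => (⨆ x, ‖v t x‖) ^ 2 /
              (1 + Real.log (Real.log (Real.exp 1 + ⨆ x, ‖v t x‖)) ^ (2 : ℝ))) (Ioo 0 (T - Ts)) ∧
            IntegrableOn (fun t : ℝ => (⨆ x, ‖FunctionSpaces.Torus.fderiv (v t) x‖) /
              (1 + Real.log (Real.log (Real.exp 1 +
                ⨆ x, ‖FunctionSpaces.Torus.fderiv (v t) x‖)) ^ (2 : ℝ))) (Ioo 0 (T - Ts))) :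
    ∀ (n : ℕ), 2 ≤ n → ∃ T₁ : ℝ, 0 < T₁ ∧ ∀ (T : ℝ), 0 < T → T ≤ T₁ →
      ∀ (U : ℝ → UnitAddTorus (Fin n) → EuclideanSpace ℝ (Fin n))
        (P : ℝ → UnitAddTorus (Fin n) → ℝ),
        FunctionSpaces.Torus.IsClassicalNSSolutionOn (Icc 0 T) 1 0 U P →
        ∀ Ts : ℝ, 0 ≤ Ts → Ts < T →
          ∃ (u : ℝ → UnitAddTorus (Fin n) → EuclideanSpace ℝ (Fin n))
            (q : ℝ → UnitAddTorus (Fin n) → ℝ),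
            FunctionSpaces.Torus.IsClassicalNSSolutionOn (Ioc 0 (T - Ts)) 1 0 u q ∧
            (∀ φ : UnitAddTorus (Fin n) → EuclideanSpace ℝ (Fin n), FunctionSpaces.Torus.IsSmooth φ →
              Tendsto (fun t => ∫ x, ⟪u t x, φ x⟫_ℝ) (𝓝[>] 0) (𝓝 (∫ x, ⟪U Ts x, φ x⟫_ℝ))) ∧
            (∫⁻ t in Ioo 0 (T - Ts), ∫⁻ x, ‖u t x‖ₑ ^ 2 < ⊤) ∧
            (∀ p : ℝ, 1 ≤ p →
              FluidPDE.Torus.MemLqLp 2 (ENNReal.ofReal p) u (Ioo 0 (T - Ts))) ∧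
            (∃ c : ℝ, 0 < c ∧ ∃ s : ℕ → ℝ, (∀ k, 0 < s k ∧ s k ≤ T - Ts) ∧
              Tendsto s atTop (𝓝 0) ∧ ∀ k, ∃ x, c / Real.sqrt (s k) ≤ ‖u (s k) x‖) ∧
            (∃ C : ℝ, ∀ t ∈ Ioc 0 (T - Ts), ∀ x, ‖u t x‖ ≤ C / Real.sqrt t ∧
              ‖FunctionSpaces.Torus.fderiv (u t) x‖ ≤ C / t) ∧
            (∃ c : ℝ, 0 < c ∧ IntegrableOn (fun t : ℝ => (⨆ x, ‖u t x‖) ^ 2 /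
              (1 + Real.log (Real.log (Real.exp 1 + ⨆ x, ‖u t x‖)) ^ c)) (Ioo 0 (T - Ts))) ∧
            (∃ c : ℝ, 0 < c ∧ IntegrableOn (fun t : ℝ =>
              (⨆ x, ‖FunctionSpaces.Torus.fderiv (u t) x‖) /
              (1 + Real.log (Real.log (Real.exp 1 +
                ⨆ x, ‖FunctionSpaces.Torus.fderiv (u t) x‖)) ^ c)) (Ioo 0 (T - Ts))) := by
  intro n hn
  obtain ⟨T₁, hT₁, h⟩ := h₂ n hn
  refine ⟨T₁, hT₁, fun T hT hTT₁ U P hU Ts hTs0 hTsT => ?_⟩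
  obtain ⟨v, w, q, hcl, hvsm, ⟨K, hK⟩, ⟨δ, β₀, β₁, hβ₀, hβ₁, hwb⟩, ⟨c₀, hc₀, s, hsI, hslim, hlow⟩,
    hvlim, hwlim, hL2, hLp, hIF, hIH⟩ := h T hT hTT₁ U P hU Ts hTs0 hTsT
  set τ : ℝ := T - Ts with hτ_def
  have hτ : 0 < τ := sub_pos.2 hTsT
  set u : ℝ → UnitAddTorus (Fin n) → EuclideanSpace ℝ (Fin n) :=
    fun t x => U (t + Ts) x + v t x + w t x with hu_def
  -- bounds of the background on `[0, T]`
  have hUsm : IsSmoothSpaceTimeOn (Icc 0 T) U := hU.smooth_velocity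
  obtain ⟨M₀, hM₀⟩ := hUsm.exists_norm_le_of_isCompact isCompact_Icc Subset.rfl
  obtain ⟨M₁₀, hM₁₀⟩ := exists_norm_fderiv_le_of_isSmoothSpaceTimeOn hT hUsm
  set M : ℝ := max M₀ 0 with hM_def
  set M₁ : ℝ := max M₁₀ 0 with hM₁_def
  have hM0 : 0 ≤ M := le_max_right _ _
  have hM₁0 : 0 ≤ M₁ := le_max_right _ _
  have hmem : ∀ t ∈ Ioc 0 τ, t + Ts ∈ Icc 0 T := fun t ht =>
    ⟨by linarith [ht.1], by rw [hτ_def] at ht; linarith [ht.2]⟩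
  have hM : ∀ t ∈ Ioc 0 τ, ∀ x, ‖U (t + Ts) x‖ ≤ M := fun t ht x =>
    (hM₀ _ (hmem t ht) x).trans (le_max_left _ _)
  have hM₁ : ∀ t ∈ Ioc 0 τ, ∀ x, ‖FunctionSpaces.Torus.fderiv (U (t + Ts)) x‖ ≤ M₁ := fun t ht x =>
    (hM₁₀ _ (hmem t ht) x).trans (le_max_left _ _)
  -- the corrector with `|δ|`
  have hwb' : ∀ t ∈ Ioc 0 τ, ∀ x, ‖w t x‖ ≤ |δ| * t ^ (-β₀) ∧
      ‖FunctionSpaces.Torus.fderiv (w t) x‖ ≤ |δ| * t ^ (-β₁) := fun t ht x =>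
    ⟨(hwb t ht x).1.trans (mul_le_mul_of_nonneg_right (le_abs_self δ) (Real.rpow_nonneg ht.1.le _)),
      (hwb t ht x).2.trans (mul_le_mul_of_nonneg_right (le_abs_self δ) (Real.rpow_nonneg ht.1.le _))⟩
  have hK0 : 0 ≤ K := by
    have h := (hK τ ⟨hτ, le_rfl⟩ 0).1
    have : 0 ≤ K / Real.sqrt τ := (norm_nonneg _).trans h
    exact (div_nonneg_iff.1 this).elim (fun h => h.1)
      (fun h => absurd h.2 (not_le.2 (Real.sqrt_pos.2 hτ)))
  -- smoothness of the slices
  have husm : IsSmoothSpaceTimeOn (Ioc 0 τ) u := hcl.smooth_velocity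
  have hUts : ∀ t ∈ Ioc 0 τ, IsSmooth (U (t + Ts)) := fun t ht => hUsm.isSmooth_slice (hmem t ht)
  have hvs : ∀ t ∈ Ioc 0 τ, IsSmooth (v t) := hvsm
  have hus : ∀ t ∈ Ioc 0 τ, IsSmooth (u t) := fun t ht => husm.isSmooth_slice ht
  have hws : ∀ t ∈ Ioc 0 τ, IsSmooth (w t) := by
    intro t ht
    have h : w t = fun x => u t x - U (t + Ts) x - v t x := by
      funext x; simp only [hu_def]; abel
    rw [h]
    exact ((hus t ht).sub (hUts t ht)).sub (hvs t ht)
  -- pointwise bounds of `u` and `∇u`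
  have hu_le : ∀ t ∈ Ioc 0 τ, ∀ x, ‖u t x‖ ≤ M + K / Real.sqrt t + |δ| * t ^ (-β₀) := by
    intro t ht x
    calc ‖u t x‖ ≤ ‖U (t + Ts) x + v t x‖ + ‖w t x‖ := norm_add_le _ _
      _ ≤ ‖U (t + Ts) x‖ + ‖v t x‖ + ‖w t x‖ := by gcongr; exact norm_add_le _ _
      _ ≤ M + K / Real.sqrt t + |δ| * t ^ (-β₀) :=
          add_le_add_three (hM t ht x) (hK t ht x).1 (hwb' t ht x).1
  have hDu_eq : ∀ t ∈ Ioc 0 τ, ∀ x, FunctionSpaces.Torus.fderiv (u t) x =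
      FunctionSpaces.Torus.fderiv (U (t + Ts)) x + FunctionSpaces.Torus.fderiv (v t) x +
        FunctionSpaces.Torus.fderiv (w t) x := by
    intro t ht x
    have h1 : u t = (U (t + Ts) + v t) + w t := rfl
    rw [h1, FunctionSpaces.Torus.fderiv_add (((hUts t ht).add (hvs t ht)).isContDiff (by simp))
      ((hws t ht).isContDiff (by simp)),
      FunctionSpaces.Torus.fderiv_add ((hUts t ht).isContDiff (by simp)) ((hvs t ht).isContDiff (by simp))]
  have hDu_le : ∀ t ∈ Ioc 0 τ, ∀ x, ‖FunctionSpaces.Torus.fderiv (u t) x‖ ≤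
      M₁ + K / t + |δ| * t ^ (-β₁) := by
    intro t ht x
    rw [hDu_eq t ht x]
    calc _ ≤ ‖FunctionSpaces.Torus.fderiv (U (t + Ts)) x + FunctionSpaces.Torus.fderiv (v t) x‖ +
          ‖FunctionSpaces.Torus.fderiv (w t) x‖ := norm_add_le _ _
      _ ≤ ‖FunctionSpaces.Torus.fderiv (U (t + Ts)) x‖ + ‖FunctionSpaces.Torus.fderiv (v t) x‖ +
          ‖FunctionSpaces.Torus.fderiv (w t) x‖ := by gcongr; exact norm_add_le _ _
      _ ≤ M₁ + K / t + |δ| * t ^ (-β₁) :=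
          add_le_add_three (hM₁ t ht x) (hK t ht x).2 (hwb' t ht x).2
  refine ⟨u, q, hcl, ?_, hL2, hLp, ?_, ?_, ?_, ?_⟩
  · -- the `𝒟'`-limit at the blow-up time
    intro φ hφ
    have hφc : Continuous φ := hφ.continuous
    -- `t ↦ ∫⟪U t, φ⟫` is continuous on `[0, T]`
    have hg : ContinuousOn (fun r => ∫ x, ⟪U r x, φ x⟫_ℝ) (Icc 0 T) :=
      (hUsm.inner (isSmoothSpaceTimeOn_const hφ _)).continuousOn_integral (convex_Icc 0 T)
    have hTs_mem : Ts ∈ Icc 0 T := ⟨hTs0, hTsT.le⟩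
    have h1 : Tendsto (fun t : ℝ => t + Ts) (𝓝[>] 0) (𝓝[Icc 0 T] Ts) := by
      refine tendsto_nhdsWithin_iff.2 ⟨?_, ?_⟩
      · have h : Tendsto (fun t : ℝ => t + Ts) (𝓝 0) (𝓝 (0 + Ts)) :=
          tendsto_id.add tendsto_const_nhds
        rw [zero_add] at h
        exact h.mono_left nhdsWithin_le_nhds
      · filter_upwards [Ioo_mem_nhdsGT hτ] with t ht
        exact hmem t ⟨ht.1, ht.2.le⟩
    have hU' : Tendsto (fun t => ∫ x, ⟪U (t + Ts) x, φ x⟫_ℝ) (𝓝[>] 0) (𝓝 (∫ x, ⟪U Ts x, φ x⟫_ℝ)) :=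
      (hg Ts hTs_mem).tendsto.comp h1
    have hsum := hU'.add ((hvlim φ hφ).add (hwlim φ hφ))
    simp only [add_zero] at hsum
    refine hsum.congr' ?_
    filter_upwards [Ioo_mem_nhdsGT hτ] with t ht
    have ht' : t ∈ Ioc 0 τ := ⟨ht.1, ht.2.le⟩
    have i1 : Integrable (fun x => ⟪U (t + Ts) x, φ x⟫_ℝ) volume :=
      ((hUts t ht').continuous.inner hφc).integrable_unitAddTorus
    have i2 : Integrable (fun x => ⟪v t x, φ x⟫_ℝ) volume :=
      ((hvs t ht').continuous.inner hφc).integrable_unitAddTorus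
    have i3 : Integrable (fun x => ⟪w t x, φ x⟫_ℝ) volume :=
      ((hws t ht').continuous.inner hφc).integrable_unitAddTorus
    have i23 : Integrable (fun x => ⟪v t x, φ x⟫_ℝ + ⟪w t x, φ x⟫_ℝ) volume := i2.add i3
    rw [← integral_add i2 i3, ← integral_add i1 i23]
    refine integral_congr_ae (ae_of_all _ fun x => ?_)
    simp only [hu_def, inner_add_left]
    ring
  · -- the lower bound along a tail of `s`
    -- the remainder `√s (M + |δ| s^{-β₀}) → 0`
    have hrem : Tendsto (fun k => Real.sqrt (s k) * M + |δ| * (s k) ^ (1 / 2 - β₀)) atTop (𝓝 0) := by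
      have h1 : Tendsto (fun k => Real.sqrt (s k) * M) atTop (𝓝 0) := by
        simpa using hslim.sqrt.mul_const M
      have h2 : Tendsto (fun k => |δ| * (s k) ^ (1 / 2 - β₀)) atTop (𝓝 0) := by
        have h := (hslim.rpow_const (Or.inr (by linarith : (0:ℝ) ≤ 1 / 2 - β₀))).const_mul |δ|
        rwa [Real.zero_rpow (by linarith : (1:ℝ) / 2 - β₀ ≠ 0), mul_zero] at h
      simpa using h1.add h2
    obtain ⟨k₀, hk₀⟩ := eventually_atTop.1 ((tendsto_order.1 hrem).2 (c₀ / 2) (by positivity))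
    refine ⟨c₀ / 2, by positivity, fun k => s (k + k₀), fun k => hsI (k + k₀),
      hslim.comp (tendsto_add_atTop_nat k₀), fun k => ?_⟩
    obtain ⟨x, hx⟩ := hlow (k + k₀)
    refine ⟨x, ?_⟩
    have hsk := hsI (k + k₀)
    have hsmem : s (k + k₀) ∈ Ioc 0 τ := ⟨hsk.1, hsk.2⟩
    have hsq : 0 < Real.sqrt (s (k + k₀)) := Real.sqrt_pos.2 hsk.1
    have hk := hk₀ (k + k₀) (Nat.le_add_left _ _)
    -- `M + |δ| s^{-β₀} ≤ (c₀/2)/√s`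
    have hrem' : M + |δ| * s (k + k₀) ^ (-β₀) ≤ (c₀ / 2) / Real.sqrt (s (k + k₀)) := by
      rw [le_div_iff₀ hsq]
      have he : |δ| * s (k + k₀) ^ (-β₀) * Real.sqrt (s (k + k₀)) = |δ| * s (k + k₀) ^ (1 / 2 - β₀) := by
        rw [Real.sqrt_eq_rpow, mul_assoc, ← Real.rpow_add hsk.1]
        ring_nf
      nlinarith [he, hk.le]
    -- `‖v‖ ≤ ‖u‖ + ‖U‖ + ‖w‖`
    have htri : ‖v (s (k + k₀)) x‖ ≤ ‖u (s (k + k₀)) x‖ + ‖U (s (k + k₀) + Ts) x‖ + ‖w (s (k + k₀)) x‖ := by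
      have h : v (s (k + k₀)) x = u (s (k + k₀)) x - U (s (k + k₀) + Ts) x - w (s (k + k₀)) x := by
        simp only [hu_def]; abel
      rw [h]
      calc _ ≤ ‖u (s (k + k₀)) x - U (s (k + k₀) + Ts) x‖ + ‖w (s (k + k₀)) x‖ := norm_sub_le _ _
        _ ≤ _ := by gcongr; exact norm_sub_le _ _
    have h1 := hM _ hsmem x
    have h2 := (hwb' _ hsmem x).1
    have h3 : c₀ / Real.sqrt (s (k + k₀)) - (c₀ / 2) / Real.sqrt (s (k + k₀)) =
        (c₀ / 2) / Real.sqrt (s (k + k₀)) := by ring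
    linarith
  · -- Type I
    set Cv : ℝ := M * Real.sqrt τ + K + |δ| * τ ^ (1 / 2 - β₀) with hCv
    set Cg : ℝ := M₁ * τ + K + |δ| * τ ^ (1 - β₁) with hCg
    refine ⟨max Cv Cg, fun t ht x => ⟨?_, ?_⟩⟩
    · have hsq : 0 < Real.sqrt t := Real.sqrt_pos.2 ht.1
      refine (hu_le t ht x).trans ?_
      refine le_trans ?_ (div_le_div_of_nonneg_right (le_max_left Cv Cg) hsq.le)
      rw [le_div_iff₀ hsq, hCv]
      have e1 : M * Real.sqrt t ≤ M * Real.sqrt τ :=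
        mul_le_mul_of_nonneg_left (Real.sqrt_le_sqrt ht.2) hM0
      have e2 : K / Real.sqrt t * Real.sqrt t = K := div_mul_cancel₀ K hsq.ne'
      have e3 : |δ| * t ^ (-β₀) * Real.sqrt t ≤ |δ| * τ ^ (1 / 2 - β₀) := by
        rw [Real.sqrt_eq_rpow, mul_assoc, ← Real.rpow_add ht.1]
        refine mul_le_mul_of_nonneg_left ?_ (abs_nonneg δ)
        rw [show -β₀ + 1 / 2 = 1 / 2 - β₀ by ring]
        exact Real.rpow_le_rpow ht.1.le ht.2 (by linarith)
      nlinarith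
    · refine (hDu_le t ht x).trans ?_
      refine le_trans ?_ (div_le_div_of_nonneg_right (le_max_right Cv Cg) ht.1.le)
      rw [le_div_iff₀ ht.1, hCg]
      have e1 : M₁ * t ≤ M₁ * τ := mul_le_mul_of_nonneg_left ht.2 hM₁0
      have e2 : K / t * t = K := div_mul_cancel₀ K ht.1.ne'
      have e3 : |δ| * t ^ (-β₁) * t ≤ |δ| * τ ^ (1 - β₁) := by
        rw [mul_assoc]
        refine mul_le_mul_of_nonneg_left ?_ (abs_nonneg δ)
        have h : t ^ (-β₁) * t = t ^ (1 - β₁) := by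
          conv_lhs => rw [show t ^ (-β₁) * t = t ^ (-β₁) * t ^ (1:ℝ) by rw [Real.rpow_one]]
          rw [← Real.rpow_add ht.1]
          ring_nf
        rw [h]
        exact Real.rpow_le_rpow ht.1.le ht.2 (by linarith)
      nlinarith
  · -- Orlicz bound (5a) for `u`, `c = 2`
    refine ⟨2, two_pos, ?_⟩
    have hSv : ∀ t ∈ Ioc 0 τ, ∀ x, ‖v t x‖ ≤ ⨆ y, ‖v t y‖ := fun t ht x =>
      norm_le_iSup_norm (hvs t ht).continuous x
    have hSv0 : ∀ t, 0 ≤ ⨆ y, ‖v t y‖ := fun t => Real.iSup_nonneg fun y => norm_nonneg _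
    have hSu0 : ∀ t, 0 ≤ ⨆ y, ‖u t y‖ := fun t => Real.iSup_nonneg fun y => norm_nonneg _
    -- `sup ‖u‖ ≤ (M + |δ| t^{-β₀} + K... )`: we only need `≤ a(t) + sup ‖v‖`, `a = M + K/√t ...`?
    -- use the sharper split `‖u‖ ≤ (M + |δ|t^{-β₀}) + ‖v‖`
    have hSu : ∀ t ∈ Ioc 0 τ, (⨆ y, ‖u t y‖) ≤ (M + |δ| * t ^ (-β₀)) + ⨆ y, ‖v t y‖ := by
      intro t ht
      refine ciSup_le fun x => ?_
      calc ‖u t x‖ ≤ ‖U (t + Ts) x + v t x‖ + ‖w t x‖ := norm_add_le _ _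
        _ ≤ ‖U (t + Ts) x‖ + ‖v t x‖ + ‖w t x‖ := by gcongr; exact norm_add_le _ _
        _ ≤ M + (⨆ y, ‖v t y‖) + |δ| * t ^ (-β₀) :=
            add_le_add_three (hM t ht x) (hSv t ht x) (hwb' t ht x).1
        _ = (M + |δ| * t ^ (-β₀)) + ⨆ y, ‖v t y‖ := by ring
    have ha0 : ∀ t ∈ Ioc 0 τ, 0 ≤ M + |δ| * t ^ (-β₀) := fun t ht => by
      have := Real.rpow_nonneg ht.1.le (-β₀); positivity
    -- the dominating function
    have hdom : IntegrableOn (fun t => 4 * (M + |δ| * t ^ (-β₀)) ^ 2 +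
        4 * ((⨆ y, ‖v t y‖) ^ 2 / (1 + Real.log (Real.log (Real.exp 1 + ⨆ y, ‖v t y‖)) ^ 2)))
        (Ioo 0 τ) := by
      refine IntegrableOn.add ?_ ?_
      · have h1 : IntegrableOn (fun t : ℝ => t ^ (-β₀)) (Ioo 0 τ) :=
          integrableOn_rpow_neg_Ioo (by linarith) hτ.le
        have h2 : IntegrableOn (fun t : ℝ => t ^ (-(2 * β₀))) (Ioo 0 τ) :=
          integrableOn_rpow_neg_Ioo (by linarith) hτ.le
        have h3 : IntegrableOn (fun t : ℝ => 4 * (M ^ 2 + 2 * M * |δ| * t ^ (-β₀) +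
            δ ^ 2 * t ^ (-(2 * β₀)))) (Ioo 0 τ) :=
          (((integrableOn_const (by rw [Real.volume_Ioo]; exact ENNReal.ofReal_ne_top)).add
            (h1.const_mul _)).add (h2.const_mul _)).const_mul 4
        refine IntegrableOn.congr_fun h3 (fun t ht => ?_) measurableSet_Ioo
        have h : t ^ (-(2 * β₀)) = (t ^ (-β₀)) ^ 2 := by
          rw [← Real.rpow_two, ← Real.rpow_mul ht.1.le]; ring_nf
        have hδ : δ ^ 2 = |δ| ^ 2 := (sq_abs δ).symm
        show 4 * (M ^ 2 + 2 * M * |δ| * t ^ (-β₀) + δ ^ 2 * t ^ (-(2 * β₀))) =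
          4 * (M + |δ| * t ^ (-β₀)) ^ 2
        rw [h, hδ]
        ring
      · have h : IntegrableOn (fun t : ℝ => 4 * ((⨆ x, ‖v t x‖) ^ 2 /
            (1 + Real.log (Real.log (Real.exp 1 + ⨆ x, ‖v t x‖)) ^ (2 : ℝ)))) (Ioo 0 τ) :=
          hIF.const_mul 4
        refine IntegrableOn.congr_fun h (fun t _ => ?_) measurableSet_Ioo
        simp only [Real.rpow_two]
    -- measurability of the integrand
    have hSuc : ContinuousOn (fun t => ⨆ y, ‖u t y‖) (Ioc 0 τ) := continuousOn_iSup_norm' husm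
    have hFc := continuousOn_orliczWeight' two_pos 2 hSuc hSu0
    refine Integrable.mono' hdom ((hFc.mono Ioo_subset_Ioc_self).aestronglyMeasurable measurableSet_Ioo) ?_
    filter_upwards [ae_restrict_mem measurableSet_Ioo] with t ht
    have ht' : t ∈ Ioc 0 τ := ⟨ht.1, ht.2.le⟩
    rw [Real.norm_eq_abs, abs_of_nonneg (by
      have := Real.rpow_nonneg (loglog_nonneg (hSu0 t)) (2:ℝ); positivity)]
    simp only [Real.rpow_two]
    exact orliczF_le_of_le_add (hSu0 t) (ha0 t ht') (hSv0 t) (hSu t ht')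
  · -- Orlicz bound (5b) for `∇u`, `c = 2`
    refine ⟨2, two_pos, ?_⟩
    have hSv : ∀ t ∈ Ioc 0 τ, ∀ x, ‖FunctionSpaces.Torus.fderiv (v t) x‖ ≤
        ⨆ y, ‖FunctionSpaces.Torus.fderiv (v t) y‖ := fun t ht x => norm_fderiv_le_iSup (hvs t ht) x
    have hSv0 : ∀ t, 0 ≤ ⨆ y, ‖FunctionSpaces.Torus.fderiv (v t) y‖ := fun t =>
      Real.iSup_nonneg fun y => norm_nonneg _
    have hSu0 : ∀ t, 0 ≤ ⨆ y, ‖FunctionSpaces.Torus.fderiv (u t) y‖ := fun t =>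
      Real.iSup_nonneg fun y => norm_nonneg _
    have hSu : ∀ t ∈ Ioc 0 τ, (⨆ y, ‖FunctionSpaces.Torus.fderiv (u t) y‖) ≤
        (M₁ + |δ| * t ^ (-β₁)) + ⨆ y, ‖FunctionSpaces.Torus.fderiv (v t) y‖ := by
      intro t ht
      refine ciSup_le fun x => ?_
      rw [hDu_eq t ht x]
      calc _ ≤ ‖FunctionSpaces.Torus.fderiv (U (t + Ts)) x + FunctionSpaces.Torus.fderiv (v t) x‖ +
            ‖FunctionSpaces.Torus.fderiv (w t) x‖ := norm_add_le _ _
        _ ≤ ‖FunctionSpaces.Torus.fderiv (U (t + Ts)) x‖ + ‖FunctionSpaces.Torus.fderiv (v t) x‖ +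
            ‖FunctionSpaces.Torus.fderiv (w t) x‖ := by gcongr; exact norm_add_le _ _
        _ ≤ M₁ + (⨆ y, ‖FunctionSpaces.Torus.fderiv (v t) y‖) + |δ| * t ^ (-β₁) :=
            add_le_add_three (hM₁ t ht x) (hSv t ht x) (hwb' t ht x).2
        _ = _ := by ring
    have ha0 : ∀ t ∈ Ioc 0 τ, 0 ≤ M₁ + |δ| * t ^ (-β₁) := fun t ht => by
      have := Real.rpow_nonneg ht.1.le (-β₁); positivity
    have hdom : IntegrableOn (fun t => 2 * (M₁ + |δ| * t ^ (-β₁)) +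
        2 * ((⨆ y, ‖FunctionSpaces.Torus.fderiv (v t) y‖) /
          (1 + Real.log (Real.log (Real.exp 1 + ⨆ y, ‖FunctionSpaces.Torus.fderiv (v t) y‖)) ^ 2)))
        (Ioo 0 τ) := by
      refine IntegrableOn.add ?_ ?_
      · have h1 : IntegrableOn (fun t : ℝ => t ^ (-β₁)) (Ioo 0 τ) :=
          integrableOn_rpow_neg_Ioo hβ₁ hτ.le
        exact ((integrableOn_const (by rw [Real.volume_Ioo]; exact ENNReal.ofReal_ne_top)).add
          (h1.const_mul _)).const_mul 2
      · have h : IntegrableOn (fun t : ℝ => 2 * ((⨆ x, ‖FunctionSpaces.Torus.fderiv (v t) x‖) /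
            (1 + Real.log (Real.log (Real.exp 1 +
              ⨆ x, ‖FunctionSpaces.Torus.fderiv (v t) x‖)) ^ (2 : ℝ)))) (Ioo 0 τ) :=
          hIH.const_mul 2
        refine IntegrableOn.congr_fun h (fun t _ => ?_) measurableSet_Ioo
        simp only [Real.rpow_two]
    have hSuc : ContinuousOn (fun t => ⨆ y, ‖FunctionSpaces.Torus.fderiv (u t) y‖) (Ioc 0 τ) :=
      continuousOn_iSup_norm_fderiv' (uniqueDiffOn_Ioc 0 τ) husm
    have hHc := continuousOn_orliczWeight' two_pos 1 hSuc hSu0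
    simp only [pow_one] at hHc
    refine Integrable.mono' hdom ((hHc.mono Ioo_subset_Ioc_self).aestronglyMeasurable measurableSet_Ioo) ?_
    filter_upwards [ae_restrict_mem measurableSet_Ioo] with t ht
    have ht' : t ∈ Ioc 0 τ := ⟨ht.1, ht.2.le⟩
    rw [Real.norm_eq_abs, abs_of_nonneg (by
      have := Real.rpow_nonneg (loglog_nonneg (hSu0 t)) (2:ℝ)
      exact div_nonneg (hSu0 t) (by positivity))]
    simp only [Real.rpow_two]
    exact orliczH_le_of_le_add (hSu0 t) (ha0 t ht') (hSv0 t) (hSu t ht')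

/-- **The barrier fact from the decomposition level** (composition of
`construction_of_decomposition` with `InstantaneousTypeIBlowup_of_construction`).
[cite: CheskidovDaiPalasek2025, §6 (proof of Thm. 1.1)] -/
theorem InstantaneousTypeIBlowup_of_decomposition
    (h₂ : ∀ (n : ℕ), 2 ≤ n → ∃ T₁ : ℝ, 0 < T₁ ∧ ∀ (T : ℝ), 0 < T → T ≤ T₁ →
      ∀ (U : ℝ → UnitAddTorus (Fin n) → EuclideanSpace ℝ (Fin n))
        (P : ℝ → UnitAddTorus (Fin n) → ℝ),
        FunctionSpaces.Torus.IsClassicalNSSolutionOn (Icc 0 T) 1 0 U P →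
        ∀ Ts : ℝ, 0 ≤ Ts → Ts < T →
          ∃ (v w : ℝ → UnitAddTorus (Fin n) → EuclideanSpace ℝ (Fin n))
            (q : ℝ → UnitAddTorus (Fin n) → ℝ),
            FunctionSpaces.Torus.IsClassicalNSSolutionOn (Ioc 0 (T - Ts)) 1 0
              (fun t x => U (t + Ts) x + v t x + w t x) q ∧
            (∀ t ∈ Ioc 0 (T - Ts), IsSmooth (v t)) ∧
            (∃ K : ℝ, ∀ t ∈ Ioc 0 (T - Ts), ∀ x, ‖v t x‖ ≤ K / Real.sqrt t ∧
              ‖FunctionSpaces.Torus.fderiv (v t) x‖ ≤ K / t) ∧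
            (∃ δ β₀ β₁ : ℝ, β₀ < 1 / 2 ∧ β₁ < 1 ∧ ∀ t ∈ Ioc 0 (T - Ts), ∀ x,
              ‖w t x‖ ≤ δ * t ^ (-β₀) ∧ ‖FunctionSpaces.Torus.fderiv (w t) x‖ ≤ δ * t ^ (-β₁)) ∧
            (∃ c₀ : ℝ, 0 < c₀ ∧ ∃ s : ℕ → ℝ, (∀ k, 0 < s k ∧ s k ≤ T - Ts) ∧
              Tendsto s atTop (𝓝 0) ∧ ∀ k, ∃ x, c₀ / Real.sqrt (s k) ≤ ‖v (s k) x‖) ∧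
            (∀ φ : UnitAddTorus (Fin n) → EuclideanSpace ℝ (Fin n), IsSmooth φ →
              Tendsto (fun t => ∫ x, ⟪v t x, φ x⟫_ℝ) (𝓝[>] 0) (𝓝 0)) ∧
            (∀ φ : UnitAddTorus (Fin n) → EuclideanSpace ℝ (Fin n), IsSmooth φ →
              Tendsto (fun t => ∫ x, ⟪w t x, φ x⟫_ℝ) (𝓝[>] 0) (𝓝 0)) ∧
            (∫⁻ t in Ioo 0 (T - Ts), ∫⁻ x, ‖U (t + Ts) x + v t x + w t x‖ₑ ^ 2 < ⊤) ∧
            (∀ p : ℝ, 1 ≤ p → FluidPDE.Torus.MemLqLp 2 (ENNReal.ofReal p)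
              (fun t x => U (t + Ts) x + v t x + w t x) (Ioo 0 (T - Ts))) ∧
            IntegrableOn (fun t : ℝ => (⨆ x, ‖v t x‖) ^ 2 /
              (1 + Real.log (Real.log (Real.exp 1 + ⨆ x, ‖v t x‖)) ^ (2 : ℝ))) (Ioo 0 (T - Ts)) ∧
            IntegrableOn (fun t : ℝ => (⨆ x, ‖FunctionSpaces.Torus.fderiv (v t) x‖) /
              (1 + Real.log (Real.log (Real.exp 1 +
                ⨆ x, ‖FunctionSpaces.Torus.fderiv (v t) x‖)) ^ (2 : ℝ))) (Ioo 0 (T - Ts))) :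
    InstantaneousTypeIBlowup :=
  InstantaneousTypeIBlowup_of_construction (construction_of_decomposition h₂)

end Decomposition

end Literature.Barriers.NavierStokesRegularity

end
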